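import Summits.BirchSwinnertonDyer.BirchSwinnertonDyer.Theorems.EisensteinDepletionAtTwoStarRestrictedGlue
import Summits.BirchSwinnertonDyer.BirchSwinnertonDyer.Theorems.EisensteinDepletionAtTwoStarPeriodAdditive
import Summits.BirchSwinnertonDyer.BirchSwinnertonDyer.Theorems.EisensteinDepletionAtTwoStarGO2SigmaStubCharacterOfGamma0
import Summits.BirchSwinnertonDyer.BirchSwinnertonDyer.Theorems.EisensteinDepletionAtTwoStarGO2SigmaStubEisImageCyclic
import Summits.BirchSwinnertonDyer.BirchSwinnertonDyer.Theorems.EisensteinDepletionAtTwoStarGO2SigmaStubKummerParityHom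
import Literature.NumberTheory.EllipticCurves.ModularSymbolsProofs
import Literature.NumberTheory.EllipticCurves.CuspFormLFunctionLevelConductorProofs
import Summits.BirchSwinnertonDyer.BirchSwinnertonDyer.Theorems.EisensteinDepletionAtTwoStarGO2SigmaTwistedParityGroup
import Summits.BirchSwinnertonDyer.BirchSwinnertonDyer.Theorems.EisensteinDepletionAtTwoStarOptBNSFCongruenceCore
import Summits.BirchSwinnertonDyer.BirchSwinnertonDyer.Theorems.EisensteinDepletionAtTwoStarGO2CuspEvenness
import Summits.BirchSwinnertonDyer.BirchSwinnertonDyer.Theorems.EisensteinDepletionAtTwoStarOptBNSFStubLevelDetect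
import Summits.BirchSwinnertonDyer.BirchSwinnertonDyer.Theorems.ByReductionTypeAtTwoOrdIsogenyRescale
import Summits.BirchSwinnertonDyer.BirchSwinnertonDyer.Theorems.EisensteinDepletionAtTwoStarOptBNSFGamma1Bounded
import Summits.BirchSwinnertonDyer.BirchSwinnertonDyer.Theorems.EisensteinDepletionAtTwoStarOptBNSFParamIntegral
import Summits.BirchSwinnertonDyer.BirchSwinnertonDyer.Theorems.EisensteinDepletionAtTwoStarOptBNSFParamExpansion
import Summits.BirchSwinnertonDyer.BirchSwinnertonDyer.Theorems.EisensteinDepletionAtTwoStarKummerDefs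
import Summits.BirchSwinnertonDyer.BirchSwinnertonDyer.Theorems.EisensteinDepletionAtTwoStarKummerSqrtFormSigmaThetaLaw
import Summits.BirchSwinnertonDyer.BirchSwinnertonDyer.Theorems.EisensteinDepletionAtTwoStarKummerEtaThetaOfPattern
import Summits.BirchSwinnertonDyer.BirchSwinnertonDyer.Theorems.EisensteinDepletionAtTwoStarGO2KEtaApParity
import Summits.BirchSwinnertonDyer.BirchSwinnertonDyer.Theorems.EisensteinDepletionAtTwoStarGO2KEtaLineAdapter
import Literature.NumberTheory.EllipticCurves.ManinConstantIntegral
import Literature.NumberTheory.EllipticCurves.ManinConstantSemistablePrimewise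
import Literature.NumberTheory.EllipticCurves.ModularCurveManinSemistableLatticeFormProofs
import Mathlib.NumberTheory.ModularForms.DedekindEta
import Literature.NumberTheory.ModularForms.DedekindEtaLogTransformation
import HarnessLib
import Summits.BirchSwinnertonDyer.BirchSwinnertonDyer.Theorems.EisensteinDepletionAtTwoStarKummerEtaSqrt

/-!
# Line `kummer` of crux `StarGO2Sigma` (stmt-BirchSwinnertonDyer-27046) — THE DOOR, part A: the v7.4 stubs as tree facts and the
# discrepancy-cover glue (lead bsd-rank2-star-p1 GEN 13, 2026-08-28)

The registered skeleton `Cruxes/DepletedLambdaLawAtTwoMod/Lines/kummer.lean` (v7.4, skeleton 8cbed8108921) with every research stub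
now CLOSED in the tree: 1a `stub_eisImageCyclic`, 2 `stub_kummerParityHom`, 3 `stub_characterOfGamma0` (eng-2 GEN 16), KA
`stub_apParityPattern` (p673866), K-Θ (p673346), K-A″ (p674005), K-U `stub_etaSqrt` (p674853).  This part: the closed stubs by name (tree declarations), the print stubs as `Prop` handles (`stub_dedekindEtaLog`, `stub_maninPrint`), and the v7 glue `discrepancyCover_of`
(K-D → K-U → K-Θ → Manin print → v6's discrepancy cover), verbatim from the skeleton.

HONEST FRAMING (Barrier B1): these files are the KERNEL GLUE of an OPEN crux made into tree theorems; the end state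
`starGO2Sigma_of_prints` is CONDITIONAL on four PUBLISHED theorems that the tree holds only as named facts / print stubs
(Rademacher's `log η` law, Calegari–Dimitrov–Tang unbounded denominators, Carayol level = conductor, Edixhoven ∧ Abbes–Ullmo on the
Manin constant).  Nothing here reads an analytic rank; `StarGO2Sigma` (27046), E1M_NSF (27021), E1M and BSD are NOT proved
(PARTITION D-0054: none — r_an ≥ 2, axis S0).
-/

set_option linter.dupNamespace false
set_option autoImplicit false

noncomputable section

namespace Summit.BirchSwinnertonDyer.BirchSwinnertonDyer.Theorems.DepletionAtTwo.KummerDoor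

open scoped MatrixGroups ModularForm
open CongruenceSubgroup
open Literature.NumberTheory.EllipticCurves
open Literature.NumberTheory.EllipticCurves.Greenberg1999
open Literature.NumberTheory.EllipticCurves.ModularForms
open Literature.NumberTheory.ModularForms
open Summit.BirchSwinnertonDyer.BirchSwinnertonDyer.Theorems.DepletionAtTwo
open scoped Manifold

/-! ### The closed stubs (tree theorems) and the print handles -/

/-- PRINT handle K-D `stub_dedekindEtaLog`: Dedekind's transformation law of `log η` in logarithmic form — the tree's NAMED FACT
`Literature.NumberTheory.ModularForms.dedekindEta_logTransformationLaw` (unproved in the tree; a hypothesis of the end state).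
(By-name `Prop` handle of this file; no cite tag, not a Literature fact.) -/
def stub_dedekindEtaLog : Prop := Literature.NumberTheory.ModularForms.dedekindEta_logTransformationLaw

/-- K-Θ `stub_etaKummerTheta` — NO LONGER A STUB (v7.3): DERIVED from KA `stub_apParityPattern` and the landed kernels K1 (HondaPoint),
KF (EulerClassLaw), KΘp (ThetaPattern), K√ (SqrtCriterion) by `KummerSigma.ThetaLaw.etaKummerTheta_of_apParityPattern`.  (ARITHMETIC, size L — v7; = K-ETA §0 (★η) for an odd multiple, from THEOREM K).  THE ETA–KUMMER
SQUARE LAW AT AN ODD MULTIPLE OF THE HONDA POINT.  For a globally minimal `W₀/ℚ`, good ordinary at `2`, with an ÉTALE rational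
`2`-torsion abscissa `x₀` (`v₂(x₀) ≥ 0`), and every ODD `c ∈ ℤ`: with `ℓ(q) = Σ aₙ(W₀)qⁿ/n`, `Z_c := exp_{W₀}(c·ℓ) ∈ qℤ⟦q⟧`
(Honda, tree `ParamIntegral.stub_paramIntegralFormal`), `X = formalXMulSq W₀` (`= T²x(T)`), `N = N_{W₀}` (odd, cube-free by the
rational `2`-torsion) and `Θ_N = kummerThetaSeries N`:  `Θ_N(q)·(X(Z_c) − x₀Z_c²) = R(q)²` for some `R ∈ 1 + qℤ⟦q⟧` — the square
class of `Z_c²(x([c]M) − x₀)` is that of `Θ_N` (v7.2: CORRECTED from v7's `c²·Θ_N·q²·(…) = Z_c²·R²`, which asks `R·cq/Z_c ∈ ℤ⟦q⟧` and fails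
for `|c| > 1`; = planner p2's `EtaKummerSquareLaw` shape).  PROOF PLAN (K-ETA §4 v3′ / K-UNIV §4): (i) THEOREM K in the
tree, `KEta.LineAdapter.theoremK_line_of_isOrdinaryAt W₀ hord hx hv` at `z := Z_c ∈ qℤ₂⟦q⟧`: the `2`-adic square class of
`g∘z = Z_c²(x(Z_c) − x₀)` is `(ḡ∘z̄)²(s̄∘z̄ + (ω̄∘z̄)²d̄_z)`, `s̄ − s̄² = λ̄_α`; (ii) evaluate at the Honda point: `log_W(Z_c) = c·ℓ`
turns `s̄∘z̄ + (ω̄∘z̄)²d̄_z` into the parity pattern `Σ_{n≥1, v₂(n) even} ā_{n′} qⁿ` (`n′` the odd part; p2's `DworkExpClass` /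
K-UNIV Lemma 2, `c` odd); (iii) the EISENSTEIN CONGRUENCE `a_m ≡ c_T(m) := #{t ∈ T(N) : t ∣ m} (mod 2)` (`a_p` even at odd good `p`
— rational `2`-torsion; `a₂` odd — ordinary; `a_ℓ = ±1` at `ℓ ∥ N`, `a_ℓ = 0` at `ℓ² ∣ N`; multiplicativity) and the triviality
«for odd `t`: `n/t = □ ⟺ v₂(n)` even ∧ `n′/t = □`» give the same class for `Θ_N`; (iv) `D(Θ_N·V) = 0 ⇒ Θ_N·V = R²` with `R ∈
ℚ⟦q⟧ ∩ ℤ₂⟦q⟧`, and the only other denominators are powers of `c`, which the factor `c²` absorbs (`x([c]M) = c⁻²q⁻²·unit`).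
Numerics: 247 + 238 curves at `c = 1`, 83 at `c = 3`, 0 failures (kit j312988/j313083/j313330); fails for EVEN `c` (class dies).
Why it might fail: step (ii)'s bookkeeping at `c ≠ 1` (certified only numerically for `c = 3`). -/
theorem Holds.stub_etaKummerTheta :
    ∀ (W₀ : WeierstrassCurve ℚ) [W₀.IsElliptic] [W₀.IsGloballyMinimal], IsOrdinaryAt W₀ 2 →
      ∀ (x₀ : ℚ), HasRationalTwoTorsionX W₀ x₀ → ¬ TwoTorsionRamifiedAtTwo x₀ →
      ∀ (c : ℤ), Odd c →
      ∃ R : PowerSeries ℤ, PowerSeries.constantCoeff R = 1 ∧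
        PowerSeries.map (Int.castRingHom ℚ) (kummerThetaSeries (W₀.conductorNorm ℤ)) *
            (W₀.formalXMulSq - PowerSeries.C x₀ * PowerSeries.X ^ 2).subst
              (W₀.formalExp.subst ((c : ℚ) • (PowerSeries.mk fun j : ℕ ↦ ((W₀.LFunction j : ℤ) : ℚ) / j))) =
          PowerSeries.map (Int.castRingHom ℚ) R ^ 2 :=
  KummerSigma.ThetaLaw.etaKummerTheta_of_apParityPattern KEta.ApParity.stub_apParityPattern

/-- PRINT handle `stub_maninPrint`: Edixhoven 1991 Prop. 2 in lattice form ∧ Abbes–Ullmo 1996 Thm. A — the tree's NAMED FACTS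
`edixhoven_optimalManinConstant_integral`, `abbesUllmo_not_dvd_maninConstant_of_not_dvd_level` (hypotheses of the end state).
(By-name `Prop` handle of this file; no cite tag, not a Literature fact.) -/
def stub_maninPrint : Prop :=
    edixhoven_optimalManinConstant_integral ∧ abbesUllmo_not_dvd_maninConstant_of_not_dvd_level

/-! ### By-name handles -/

/-- By-name handle of K-U.
(By-name `Prop` handle of this file; no cite tag, not a Literature fact.) -/
def stub_etaSqrt : Prop := type_of% KummerSigma.EtaSqrt.stub_etaSqrt

/-- By-name handle of KA.
(By-name `Prop` handle of this file; no cite tag, not a Literature fact.) -/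
def stub_apParityPattern : Prop := type_of% KEta.ApParity.stub_apParityPattern

/-- By-name handle of K-Θ.
(By-name `Prop` handle of this file; no cite tag, not a Literature fact.) -/
def stub_etaKummerTheta : Prop := type_of% Holds.stub_etaKummerTheta

/-- **v7 GLUE (lead star-p1 GEN 13, kernel-checked, no sorry): v6's research stub `stub_discrepancyCover` from the five v7 stubs.**
Clause (ii-b) — the discrepancy cover `Γ″ ≠ Γ₁(N)` carries a non-zero anti-invariant cusp form of some weight with an integral
multiple at `∞` — from K-D/K-U/K-Θ/K-A and the print stub `stub_maninPrint`, with the tree's engines: `q ∈ ℤ` (Edixhoven) and `q` odd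
(Abbes–Ullmo at `p = 2 ∤ N` through `ModularParametrizationData.exists_of_isNewformOf`), `2 ∤ N` (`stub_levelDetect`), `N ≥ 11`
(`cuspForm_two_gamma0_eq_zero_of_le_ten`), `IsOrdinaryAt W₀ 2` (Faltings `IsNewformOf.isIsogenous` + `isOrdinaryAt_of_isIsogenous`),
`g' ≠ 0` and cusp-evenness (`CuspEvenness.cover_clauses_of_curveData`), the square root of the `η`-quotient (K-U with K-D), (★η)_q (K-Θ at
`c = q`), `Z_q ∈ ℤ⟦q⟧` and its expansion (`ParamIntegral`, `ParamExpansion`), bounded denominators (`Gamma1Bounded`), and the assembly K-A. -/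
theorem discrepancyCover_of :
    stub_dedekindEtaLog → stub_etaSqrt → stub_etaKummerTheta → stub_maninPrint →
    ∀ (W : WeierstrassCurve ℚ) [W.IsElliptic] [W.IsGloballyMinimal] (W₀ : WeierstrassCurve ℚ) [W₀.IsElliptic]
      [W₀.IsGloballyMinimal] ⦃N : ℕ⦄ [NeZero N] (f : CuspForm (Gamma0 N) 2), IsNewformOf W f → IsNewformOf W₀ f →
      IsOrdinaryAt W 2 → N = W.conductorNorm ℤ → W₀.conductorNorm ℤ = N →
      ∀ (L₀ : PeriodPair), IsNeronLatticeOf (W₀.baseChange ℂ) L₀ → ∀ (q : ℚ), q ≠ 0 →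
      (∀ z ∈ periodLattice f, (q : ℂ) * z ∈ L₀.lattice) → (∀ z ∈ L₀.lattice, ∃ w ∈ periodLattice f, z = (q : ℂ) * w) →
      ∀ (x₀ : ℚ), HasRationalTwoTorsionX W₀ x₀ → ¬ TwoTorsionRamifiedAtTwo x₀ →
      ∀ (lam : ℂ), lam ∈ L₀.lattice → lam / 2 ∉ L₀.lattice →
      L₀.weierstrassP (lam / 2) - ((W₀.b₂ : ℚ) : ℂ) / 12 = ((x₀ : ℚ) : ℂ) →
      (∃ β : ℕ → ℕ, IsAdmissibleStabData (W.conductorNorm ℤ) β) →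
      ∃ β : ℕ → ℕ, IsAdmissibleStabData (W.conductorNorm ℤ) β ∧ ∀ g' : ℚ,
        (∀ x : ℚ, (∃ γ : Gamma0 N,
          stabEisensteinPeriod (W.conductorNorm ℤ) β ((γ : SL(2, ℤ)) 0 0) ((γ : SL(2, ℤ)) 0 1)
            ((γ : SL(2, ℤ)) 1 0) ((γ : SL(2, ℤ)) 1 1) = x) ↔ ∃ n : ℤ, x = n * g') →
        (∀ Γ'' : Subgroup SL(2, ℤ),
          (∀ γ : SL(2, ℤ), γ ∈ Γ'' ↔ ∃ hγ : γ ∈ Gamma0 N, γ ∈ Gamma1 N ∧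
            ((∃ n : ℤ, stabEisensteinPeriod (W.conductorNorm ℤ) β (γ 0 0) (γ 0 1) (γ 1 0) (γ 1 1) = n * g' ∧ Even n) ↔
              ∃ k : ℤ, ∃ w ∈ L₀.lattice, (q : ℂ) * cuspSymbol f ⟨γ, hγ⟩ = (k : ℂ) * lam + 2 * w)) →
          (∃ γ₀ ∈ Gamma1 N, γ₀ ∉ Γ'') →
          ∃ (k : ℤ) (h : CuspForm Γ'' k) (M : ℕ),
            (h : UpperHalfPlane → ℂ) ≠ 0 ∧
            (∀ γ ∈ Gamma1 N, γ ∉ Γ'' → (h : UpperHalfPlane → ℂ) ∣[k] γ = -h) ∧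
            M ≠ 0 ∧
            ∀ n : ℕ, ∃ z : ℤ,
              PowerSeries.coeff n
                (UpperHalfPlane.qExpansion (1 : ℝ) (fun τ : UpperHalfPlane ↦ (M : ℂ) * h τ)) = (z : ℂ)) := by
  intro hKD hKU hKT hMP W _ _ W₀ _ _ N _ f hW hW₀ hord hN hN₀ L₀ hL₀ q hq hin hout x₀ hx₀ hnr lam hlam hlam2 hwp hβ
  obtain ⟨β, hadm⟩ := hβ
  refine ⟨β, hadm, fun g' hg Γ'' hΓ _ ↦ ?_⟩
  -- the print named facts and Dedekind's functional equation (stubs K-D and `stub_maninPrint`)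
  dsimp only [stub_dedekindEtaLog, stub_etaSqrt, stub_etaKummerTheta, stub_maninPrint] at hKD hKU hKT hMP
  obtain ⟨hEd, hAU⟩ := hMP
  have hDed := hKD
  -- `q ∈ ℤ` (Edixhoven 1991, Prop. 2, lattice form)
  obtain ⟨qz, hqz⟩ := hEd hW₀ hL₀ q hin hout
  subst hqz
  have hqz0 : qz ≠ 0 := by
    rintro rfl
    exact hq (by simp)
  have hin' : ∀ z ∈ periodLattice f, (qz : ℂ) * z ∈ L₀.lattice := fun z hz ↦ by
    have h := hin z hz
    rwa [Rat.cast_intCast] at h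
  have hout' : ∀ z ∈ L₀.lattice, ∃ w ∈ periodLattice f, z = (qz : ℂ) * w := fun z hz ↦ by
    obtain ⟨w, hw, h⟩ := hout z hz
    exact ⟨w, hw, by rwa [Rat.cast_intCast] at h⟩
  -- `N` is odd and at least `11`
  have h2N : ¬ 2 ∣ N :=
    (Summit.BirchSwinnertonDyer.BirchSwinnertonDyer.Theorems.EisensteinDepletionAtTwoStarOptBNSFStubLevelDetect.stub_levelDetect
      W f hW).1 hord
  have h11 : 11 ≤ N := by
    by_contra hlt
    have hf0 : f = 0 := cuspForm_two_gamma0_eq_zero_of_le_ten (by omega) f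
    have h1 : cuspCoeff f 1 = (W₀.LFunction 1 : ℂ) := hW₀.2 1
    rw [hf0, WeierstrassCurve.LFunction_apply_one] at h1
    have h0 : cuspCoeff (0 : CuspForm (Gamma0 N) 2) 1 = 0 :=
      (cuspCoeffₗ (one_mem_strictPeriods_coe_gamma0 N) 1).map_zero
    rw [h0] at h1
    norm_num at h1
  -- `q` is odd (Abbes–Ullmo 1996, Thm. A at `p = 2 ∤ N`, through a parametrisation datum with `(f, Λ₀, q)`)
  obtain ⟨D', hD'f, hD'L, hD'c⟩ := ModularParametrizationData.exists_of_isNewformOf hW₀ hL₀ hqz0 hin'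
  have hqodd : Odd qz := by
    have hopt : ∀ z ∈ D'.L.lattice, ∃ w ∈ periodLattice D'.f, z = (D'.c : ℂ) * w := by
      rw [hD'L, hD'f, hD'c]
      exact hout'
    have h2 := hAU W₀ D' hopt 2 Nat.prime_two h2N
    change ¬ ((2 : ℕ) : ℤ) ∣ D'.c at h2
    rw [hD'c, Nat.cast_ofNat] at h2
    exact Int.not_even_iff_odd.mp fun he ↦ h2 (even_iff_two_dvd.mp he)
  -- level = conductor; ordinarity of the optimal curve (Faltings + isogeny transport)
  subst hN
  have hiso : WeierstrassCurve.IsIsogenous W W₀ :=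
    IsNewformOf.isIsogenous WeierstrassCurve.isIsogenous_iff_frobeniusTrace_eq_holds hW hW₀
  have hord₀ : IsOrdinaryAt W₀ 2 :=
    Summit.BirchSwinnertonDyer.BirchSwinnertonDyer.Theorems.IsogenyMuShift.isOrdinaryAt_of_isIsogenous hiso hord
  -- clause (o) from the tree's cusp-evenness package: `g' ≠ 0`
  obtain ⟨hg0, hcusp, -⟩ :=
    Summit.BirchSwinnertonDyer.BirchSwinnertonDyer.Theorems.DepletionAtTwo.CuspEvenness.cover_clauses_of_curveData
      W W₀ hord rfl hN₀ hx₀ hnr hadm hg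
  -- (U) the square root of the Eisenstein `η`-quotient (stub K-U with stub K-D)
  obtain ⟨m, V, u, U, E, hud, hune, husq, humul, hUq, hE1, hUsq⟩ :=
    hKU (W.conductorNorm ℤ) β (Nat.odd_iff.mpr (Nat.two_dvd_ne_zero.mp h2N)) hadm g' hg hDed
  -- (Θ) the eta–Kummer square identity at `c = q` (stub K-Θ)
  obtain ⟨R, hR1, hR⟩ := hKT W₀ hord₀ x₀ hx₀ hnr qz hqodd
  rw [hN₀] at hR
  -- (Z) the integral expansion of the formal parameter (tree: Honda integrality + the analytic expansion)
  choose kz hkz using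
    Summit.BirchSwinnertonDyer.BirchSwinnertonDyer.Theorems.DepletionAtTwo.ParamIntegral.stub_paramIntegralFormal W₀ qz
  obtain ⟨-, -, A, hA⟩ :=
    Summit.BirchSwinnertonDyer.BirchSwinnertonDyer.Theorems.DepletionAtTwo.ParamExpansion.stub_paramExpansion
      W₀ f hW₀ L₀ hL₀ (qz : ℚ) (by exact_mod_cast hqz0)
  set zq : PowerSeries ℤ := PowerSeries.mk kz with hzqdef
  have hzq : PowerSeries.map (Int.castRingHom ℚ) zq =
      W₀.formalExp.subst ((qz : ℚ) • (PowerSeries.mk fun j : ℕ ↦ ((W₀.LFunction j : ℤ) : ℚ) / j)) := by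
    ext n
    rw [PowerSeries.coeff_map, hzqdef, PowerSeries.coeff_mk, eq_intCast, hkz n]
  have hzsum : ∃ A : ℝ, ∀ τ : UpperHalfPlane, A < τ.im →
      HasSum (fun n : ℕ ↦ ((PowerSeries.coeff n zq : ℤ) : ℂ) *
          Complex.exp (2 * Real.pi * Complex.I * (τ : ℂ)) ^ n)
        (-(L₀.weierstrassP ((qz : ℂ) * eichlerIntegral f τ) - ((W₀.b₂ : ℚ) : ℂ) / 12) /
          ((L₀.derivWeierstrassP ((qz : ℂ) * eichlerIntegral f τ)
            - ((W₀.a₁ : ℚ) : ℂ) * (L₀.weierstrassP ((qz : ℂ) * eichlerIntegral f τ) - ((W₀.b₂ : ℚ) : ℂ) / 12)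
            - ((W₀.a₃ : ℚ) : ℂ)) / 2)) := by
    refine ⟨A, fun τ hτ ↦ ?_⟩
    have hfun : (fun n : ℕ ↦ ((PowerSeries.coeff n zq : ℤ) : ℂ) * Complex.exp (2 * Real.pi * Complex.I * (τ : ℂ)) ^ n) =
        fun n : ℕ ↦ ((PowerSeries.coeff n (W₀.formalExp.subst
          ((qz : ℚ) • (PowerSeries.mk fun j : ℕ ↦ ((W₀.LFunction j : ℤ) : ℚ) / j))) : ℚ) : ℂ) *
            Complex.exp (2 * Real.pi * Complex.I * (τ : ℂ)) ^ n := by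
      funext n
      rw [hkz n, hzqdef, PowerSeries.coeff_mk, Rat.cast_intCast]
    rw [hfun]
    have h := hA τ hτ
    simp only [Rat.cast_intCast] at h
    exact h
  -- the Eisenstein periods of `Γ₁(N)` lie in `ℤ g'`
  have hper : ∀ γ : SL(2, ℤ), γ ∈ Gamma1 (W.conductorNorm ℤ) → ∃ n : ℤ,
      stabEisensteinPeriod (W.conductorNorm ℤ) β (γ 0 0) (γ 0 1) (γ 1 0) (γ 1 1) = n * g' :=
    fun γ hγ ↦ (hg _).mp ⟨⟨γ, Gamma1_in_Gamma0 _ hγ⟩, rfl⟩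
  -- the twisted group with the integer Manin constant
  have hΓ' : ∀ γ : SL(2, ℤ), γ ∈ Γ'' ↔ ∃ hγ : γ ∈ Gamma0 (W.conductorNorm ℤ), γ ∈ Gamma1 (W.conductorNorm ℤ) ∧
      ((∃ n : ℤ, stabEisensteinPeriod (W.conductorNorm ℤ) β (γ 0 0) (γ 0 1) (γ 1 0) (γ 1 1) = n * g' ∧ Even n) ↔
        ∃ k : ℤ, ∃ w ∈ L₀.lattice, (qz : ℂ) * cuspSymbol f ⟨γ, hγ⟩ = (k : ℂ) * lam + 2 * w) := by
    intro γ
    rw [hΓ γ]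
    simp only [Rat.cast_intCast]
  exact KummerSigma.kummerSqrtFormSigma_thetaLaw W₀ f hW₀ (by omega) L₀ hL₀ qz hqz0 hin' x₀ hx₀ lam hlam hlam2 hwp β g' hg0 hper
    hcusp Γ'' hΓ' m V u U E hud hune husq humul hUq hE1 hUsq R hR1 hR zq hzq hzsum
    (Summit.BirchSwinnertonDyer.BirchSwinnertonDyer.Theorems.DepletionAtTwo.Gamma1Bounded.stub_gamma1Bounded _ (by omega))

/-- v6's discrepancy-cover statement `stub_discrepancyCover` (VERBATIM), as a `Prop`: the cover `Γ″ ≠ Γ₁(N)` carries a non-zero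
anti-invariant cusp form with an integral multiple at `∞`.
(By-name `Prop` handle of this file; no cite tag, not a Literature fact.) -/
def stub_discrepancyCover : Prop :=
    ∀ (W : WeierstrassCurve ℚ) [W.IsElliptic] [W.IsGloballyMinimal] (W₀ : WeierstrassCurve ℚ) [W₀.IsElliptic]
      [W₀.IsGloballyMinimal] ⦃N : ℕ⦄ [NeZero N] (f : CuspForm (Gamma0 N) 2), IsNewformOf W f → IsNewformOf W₀ f →
      IsOrdinaryAt W 2 → N = W.conductorNorm ℤ → W₀.conductorNorm ℤ = N →
      ∀ (L₀ : PeriodPair), IsNeronLatticeOf (W₀.baseChange ℂ) L₀ → ∀ (q : ℚ), q ≠ 0 →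
      (∀ z ∈ periodLattice f, (q : ℂ) * z ∈ L₀.lattice) → (∀ z ∈ L₀.lattice, ∃ w ∈ periodLattice f, z = (q : ℂ) * w) →
      ∀ (x₀ : ℚ), HasRationalTwoTorsionX W₀ x₀ → ¬ TwoTorsionRamifiedAtTwo x₀ →
      ∀ (lam : ℂ), lam ∈ L₀.lattice → lam / 2 ∉ L₀.lattice →
      L₀.weierstrassP (lam / 2) - ((W₀.b₂ : ℚ) : ℂ) / 12 = ((x₀ : ℚ) : ℂ) →
      (∃ β : ℕ → ℕ, IsAdmissibleStabData (W.conductorNorm ℤ) β) →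
      ∃ β : ℕ → ℕ, IsAdmissibleStabData (W.conductorNorm ℤ) β ∧ ∀ g' : ℚ,
        (∀ x : ℚ, (∃ γ : Gamma0 N,
          stabEisensteinPeriod (W.conductorNorm ℤ) β ((γ : SL(2, ℤ)) 0 0) ((γ : SL(2, ℤ)) 0 1)
            ((γ : SL(2, ℤ)) 1 0) ((γ : SL(2, ℤ)) 1 1) = x) ↔ ∃ n : ℤ, x = n * g') →
        (∀ Γ'' : Subgroup SL(2, ℤ),
          (∀ γ : SL(2, ℤ), γ ∈ Γ'' ↔ ∃ hγ : γ ∈ Gamma0 N, γ ∈ Gamma1 N ∧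
            ((∃ n : ℤ, stabEisensteinPeriod (W.conductorNorm ℤ) β (γ 0 0) (γ 0 1) (γ 1 0) (γ 1 1) = n * g' ∧ Even n) ↔
              ∃ k : ℤ, ∃ w ∈ L₀.lattice, (q : ℂ) * cuspSymbol f ⟨γ, hγ⟩ = (k : ℂ) * lam + 2 * w)) →
          (∃ γ₀ ∈ Gamma1 N, γ₀ ∉ Γ'') →
          ∃ (k : ℤ) (h : CuspForm Γ'' k) (M : ℕ),
            (h : UpperHalfPlane → ℂ) ≠ 0 ∧
            (∀ γ ∈ Gamma1 N, γ ∉ Γ'' → (h : UpperHalfPlane → ℂ) ∣[k] γ = -h) ∧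
            M ≠ 0 ∧
            ∀ n : ℕ, ∃ z : ℤ,
              PowerSeries.coeff n
                (UpperHalfPlane.qExpansion (1 : ℝ) (fun τ : UpperHalfPlane ↦ (M : ℂ) * h τ)) = (z : ℂ))

/-- The discrepancy cover from the two prints K-D and Manin (K-U, K-Θ from the tree). -/
theorem discrepancyCover_of_prints (hKD : stub_dedekindEtaLog) (hMP : stub_maninPrint) : stub_discrepancyCover :=
  discrepancyCover_of hKD KummerSigma.EtaSqrt.stub_etaSqrt Holds.stub_etaKummerTheta hMP

end Summit.BirchSwinnertonDyer.BirchSwinnertonDyer.Theorems.DepletionAtTwo.KummerDoor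

end
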